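import Summits.ValiantsHypothesis.ValiantsHypothesis.Theorems.LacunarySymmetroidMatrixDescartesCensusBox20
import Summits.ValiantsHypothesis.ValiantsHypothesis.Theorems.LacunarySymmetroidMatrixDescartesCensusTNCUnifB

/-!
# `MatrixDescartes` census — door A on a COMPLETE RAY of supports: `ζ(2,6; 0,1,4,10,12,N) ≤ 19` for EVERY `N : ℕ`

HONEST FRAMING.  Object-search cell `pub-symmetroid`, door-A item `Theses.LacunarySymmetroid.DoorA26 = PosRootLawAt 2 6 19`
(stmt-ValiantsHypothesis-19979; OPEN, typed, never asserted).  This file assembles, from theorems already in the tree, the first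
ONE-PARAMETER FAMILY OF SUPPORTS WITH NO THRESHOLD on which the door-A row holds: for every natural number `N` (sorted or not,
repeated or not), every real symmetric `2 × 2` pencil on the exponent vector `(0,1,4,10,12,N)` has at most `19 = D(2,6) − 1` distinct
positive roots of its determinant (`doorA26_on_ray_0_1_4_10_12`).  The three regimes: `N ≤ 20` is the kernel BOX20 theorem
(`Census.doorA26_box20`, engine-3/typer); `21 ≤ N ≤ 24` is free, because each of these four supports has a repeated pair sum
(`1+21 = 10+12`, `0+22 = 10+12`, `1+23 = 12+12`, `0+24 = 12+12`), hence at most `20` monomials and at most `19` positive roots by the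
support-level Descartes bound (`Census.posRoots_two_le_of_card_pairSums`); `N ≥ 25` is the typer's UNIFORM T-NC certificate
`Census.posRoots_le_19_on_2_6_0_1_4_10_12_N` (theory g4's uniform-in-`N` LP certificate, threshold `2·12 + 1`).  So along this ray the
«all-supports residue outside the box» is EMPTY.  What is NOT here: any other ray (for the record core `(0,9,11,12,17)` the gap
`21 ≤ N ≤ 34` contains Sidon supports not yet certified in the kernel), the `V = 19` layer, anything about `DoorA26` on all supports,
about the crux `MatrixDescartes` (stmt-ValiantsHypothesis-18050), or about `VP ≠ VNP`.

[folklore] Assembly of kernel theorems of the tree; elementary.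
-/

-- `Summit.ValiantsHypothesis.ValiantsHypothesis.…` repeats a component by the D-0017 layout
-- (single-conjunct summit), which the `dupNamespace` linter flags; the name is mandated.
set_option linter.dupNamespace false

namespace Summit.ValiantsHypothesis.ValiantsHypothesis.Theorems.LacunarySymmetroidMatrixDescartes.Census

open Polynomial Finset
open scoped BigOperators Polynomial Matrix
open Summit.ValiantsHypothesis.ValiantsHypothesis.Theorems.MatrixDescartes.Negative (PosRootLawAt)

/-- The four supports `(0,1,4,10,12,N)`, `21 ≤ N ≤ 24`, are NOT 2-Sidon: each has at most `20` distinct pair sums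
(`1+21 = 10+12`, `0+22 = 10+12`, `1+23 = 12+12`, `0+24 = 12+12`). [folklore] -/
theorem card_pairSums_0_1_4_10_12_le (N : ℕ) (h21 : 21 ≤ N) (h24 : N ≤ 24) :
    ((Finset.univ : Finset (Fin 6 × Fin 6)).image
      (fun p => (![0, 1, 4, 10, 12, N] : Fin 6 → ℕ) p.1 + (![0, 1, 4, 10, 12, N] : Fin 6 → ℕ) p.2)).card ≤ 20 := by
  interval_cases N <;> decide

/-- A support with a window of width `20` containing all its exponents satisfies the door-A row (restatement of
`Census.doorA26_box20` for the literal vector `(0,1,4,10,12,N)`, `N ≤ 20`). [folklore] -/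
theorem doorA26_on_0_1_4_10_12_of_le_20 (N : ℕ) (hN : N ≤ 20) :
    PosRootLawOn 2 6 19 (![0, 1, 4, 10, 12, N] : Fin 6 → ℕ) := by
  apply doorA26_box20
  intro i j
  fin_cases i <;> fin_cases j <;> simp <;> omega

/-- The non-Sidon gap of the ray: for `21 ≤ N ≤ 24` the door-A row on `(0,1,4,10,12,N)` is the support-level Descartes bound
(at most `20` monomials). [folklore] -/
theorem doorA26_on_0_1_4_10_12_of_gap (N : ℕ) (h21 : 21 ≤ N) (h24 : N ≤ 24) :
    PosRootLawOn 2 6 19 (![0, 1, 4, 10, 12, N] : Fin 6 → ℕ) := by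
  intro S _hS
  exact posRoots_two_le_of_card_pairSums (K := 6) (B := 19) (by norm_num) _
    (by have h := card_pairSums_0_1_4_10_12_le N h21 h24; omega) S

/-- **Door A on a COMPLETE RAY (no threshold): `ζ(2,6; 0,1,4,10,12,N) ≤ 19` for EVERY natural number `N`.**  On no exponent
vector `(0,1,4,10,12,N)` does a real symmetric `2 × 2` six-term pencil have `20 = D(2,6)` distinct positive det-roots: `N ≤ 20` by the
kernel BOX20 theorem, `21 ≤ N ≤ 24` by a repeated pair sum (Descartes), `N ≥ 25` by the uniform T-NC certificate of the family.  The
first infinite one-parameter family of supports on which the door-A table row is a theorem for all parameter values. [folklore] -/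
theorem doorA26_on_ray_0_1_4_10_12 (N : ℕ) : PosRootLawOn 2 6 19 (![0, 1, 4, 10, 12, N] : Fin 6 → ℕ) := by
  by_cases h20 : N ≤ 20
  · exact doorA26_on_0_1_4_10_12_of_le_20 N h20
  by_cases h24 : N ≤ 24
  · exact doorA26_on_0_1_4_10_12_of_gap N (by omega) h24
  · intro S hS
    exact posRoots_le_19_on_2_6_0_1_4_10_12_N N (by omega) S hS

/-- The same ray read in the row currency of `PosRootLawAt`: the exponent vectors `(0,1,4,10,12,N)` contribute no counterexample
to `DoorA26 = PosRootLawAt 2 6 19` (which remains OPEN: it quantifies over ALL exponent vectors). [folklore] -/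
theorem doorA26_on_ray_0_1_4_10_12_card (N : ℕ) (S : Fin 6 → Matrix (Fin 2) (Fin 2) ℝ) (hS : ∀ l, (S l).IsSymm) :
    ((∑ l, ((X : ℝ[X]) ^ (![0, 1, 4, 10, 12, N] : Fin 6 → ℕ) l) • (S l).map C).det.roots.toFinset.filter
      (fun t => 0 < t)).card ≤ 19 :=
  doorA26_on_ray_0_1_4_10_12 N S hS

end Summit.ValiantsHypothesis.ValiantsHypothesis.Theorems.LacunarySymmetroidMatrixDescartes.Census
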